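import Mathlib
import Summits.ValiantsHypothesis.ValiantsHypothesis.Theorems.KPlusLogSqLawTropicalBSeparable
import Summits.ValiantsHypothesis.ValiantsHypothesis.Theorems.KPlusLogSqLawTropicalBClassCircuits
import Summits.ValiantsHypothesis.ValiantsHypothesis.Theorems.KPlusLogSqLawTropicalBTwoSidedSeparableMoves

/-!
# Route «KPlusLogSqLaw», crux `TropicalB` (stmt-ValiantsHypothesis-19771) — THE TWO-SIDED SEPARABLE SECTOR, part 3: THE SECTOR LAW
# «every dominant chain has length ≤ m · (height of ANY integer vector sign-equivalent to the exponents on balanced sign vectors)»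

HONEST FRAMING.  Helper toward the registered stubs `stub_tropThin` / `stub_tropFat` of `Cruxes/TropicalB/Lines/birth.lean` (crux
`Summit.ValiantsHypothesis.ValiantsHypothesis.Theses.KPlusLogSqLaw.TropicalB`, item stmt-ValiantsHypothesis-19771, route KPlusLogSqLaw;
cell `pub-symmetroid`, seat val-sym-trop-p1 g19, 2026-08-28; `--supports … --as helper`).  A SECTOR theorem (two-sided separable
designs with a fine tie-break, see part 2 `…TropicalBTwoSidedSeparableMoves`); nothing here bounds `TropicalB` for general designs,
and nothing bears on `WeakLifting`, DoorA26 / DoorA34, `MatrixDescartes` (stmt-ValiantsHypothesis-18050) or VP ≠ VNP.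

THE LAW.  Sector: `d l = M·e l`, `v a b l = M(r a l + c b l) + w a b`, `0 ≤ w ≤ B`, `m·B < M`, full support.  Call `u : Fin K → ℤ`
SIGN-EQUIVALENT to `e` if for every `z : Fin K → {−1,0,1}` with `Σ z = 0`:  `0 ≤ ⟨e,z⟩ → 0 ≤ ⟨u,z⟩` and `0 < ⟨e,z⟩ → 0 < ⟨u,z⟩`.
* `potential_step` — for such `u`, the column potential `P(p) = Σ_b u(class of column b)` satisfies `P(p) + 1 ≤ P(p')` whenever `p` is
  dominant at `θa`, `p' ≠ p` dominant at `θb > θa`.  PROOF: the changed agents form a balanced family of arcs on the classes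
  (`changed_balanced`); by part 1 (`ClassCircuit.circuit_potential`) it suffices to treat its simple balanced sub-families `S`; the move
  inequality of part 2 at `θa` (move `S` forward from `p`) and at `θb` (move `S` back from `p'`) give `θa·δ(S) ≤ γ(S) ≤ θb·δ(S)`, hence
  `δ(S) ≥ 0`: EVERY CIRCUIT POINTS UP; a simple family changes each class count by at most one (`circuit_sign`), so sign-equivalence
  transfers `δ(S) ≥ 0` / `> 0` to the potential; and the total `e`-slope strictly increases (`sum_d_lt_of_dominant`).
* `chain_le` — **every chain of pairwise-consecutive-distinct terms dominant at strictly increasing integer slopes has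
  `n ≤ m · (U₁ − U₀)`** for any sign-equivalent `u` with values in `[U₀, U₁]`; `chain_le_alt` — the same for sign-alternating chains
  (the hypothesis list of `TropicalCensus.TropRootLawAt`).
READING.  A non-counting mechanism (flow exchange + small potential): the bound depends on `e` only through its SIGN CELL in the
arrangement of balanced `{−1,0,1}`-vectors, not on its size — `u = e` recovers the spread bound divided by the coarse scale, `K = 3`
gives `2m` (exact in the hub census; compare SHIFT-THREE's `C(m+2,2) − 1` for general designs), `K = 4` gives `4m`, dominant-digit
exponents give `m·(2^{K−1} − 1)`, i.e. the crux's inequality with `C = 1` (part 4, `…TwoSidedSeparableRows`).  So the free permutation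
register of this dense in-window sector cannot multiply digits.  [this file]
-/

set_option linter.dupNamespace false
set_option autoImplicit false

namespace Summit.ValiantsHypothesis.ValiantsHypothesis.Theorems.KPlusLogSqLaw

namespace TwoSided

open Summit.ValiantsHypothesis.ValiantsHypothesis.Theorems.MatrixDescartes.Negative
open scoped BigOperators
open Finset

variable {m K : ℕ}

/-! ## 1. The changed agents are balanced -/

/-- indicator bookkeeping: `[x ≠ y][x = l] = [x = l] − [x = y][x = l]`. [folklore] -/
theorem ind_ne_inner_left (x y : Fin m → Fin K) (l : Fin K) :
    (∑ a, if x a ≠ y a then (if x a = l then (1 : ℤ) else 0) else 0) =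
      (∑ a, if x a = l then (1 : ℤ) else 0) - ∑ a, if x a = y a then (if x a = l then (1 : ℤ) else 0) else 0 := by
  rw [← Finset.sum_sub_distrib]
  refine Finset.sum_congr rfl fun a _ => ?_
  by_cases h1 : x a = y a
  · rw [if_neg (not_not.mpr h1), if_pos h1]; ring
  · rw [if_pos h1, if_neg h1]; ring

/-- indicator bookkeeping: `[x ≠ y][y = l] = [y = l] − [x = y][x = l]`. [folklore] -/
theorem ind_ne_inner_right (x y : Fin m → Fin K) (l : Fin K) :
    (∑ a, if x a ≠ y a then (if y a = l then (1 : ℤ) else 0) else 0) =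
      (∑ a, if y a = l then (1 : ℤ) else 0) - ∑ a, if x a = y a then (if x a = l then (1 : ℤ) else 0) else 0 := by
  rw [← Finset.sum_sub_distrib]
  refine Finset.sum_congr rfl fun a _ => ?_
  by_cases h1 : x a = y a
  · rw [if_neg (not_not.mpr h1), if_pos h1, h1]; ring
  · rw [if_pos h1, if_neg h1]; ring

/-- **The changed agents form a balanced family** as soon as heads and tails have the same class totals. [this file] -/
theorem changed_balanced (tlR hdR tlC hdC : Fin m → Fin K) (l : Fin K)
    (h : (∑ a, if hdR a = l then (1 : ℤ) else 0) + (∑ b, if hdC b = l then (1 : ℤ) else 0) =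
      (∑ a, if tlR a = l then (1 : ℤ) else 0) + (∑ b, if tlC b = l then (1 : ℤ) else 0)) :
    ((univ.filter fun i : Fin m ⊕ Fin m => Sum.elim tlR tlC i ≠ Sum.elim hdR hdC i).filter
        fun i => Sum.elim hdR hdC i = l).card =
      ((univ.filter fun i : Fin m ⊕ Fin m => Sum.elim tlR tlC i ≠ Sum.elim hdR hdC i).filter
        fun i => Sum.elim tlR tlC i = l).card := by
  have e1 : (((univ.filter fun i : Fin m ⊕ Fin m => Sum.elim tlR tlC i ≠ Sum.elim hdR hdC i).filter
        fun i => Sum.elim hdR hdC i = l).card : ℤ) =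
      (∑ a, if tlR a ≠ hdR a then (if hdR a = l then (1 : ℤ) else 0) else 0) +
        ∑ b, if tlC b ≠ hdC b then (if hdC b = l then (1 : ℤ) else 0) else 0 := by
    rw [card_filter_eq_sum_ite, Finset.sum_filter, Fintype.sum_sum_type]; rfl
  have e2 : (((univ.filter fun i : Fin m ⊕ Fin m => Sum.elim tlR tlC i ≠ Sum.elim hdR hdC i).filter
        fun i => Sum.elim tlR tlC i = l).card : ℤ) =
      (∑ a, if tlR a ≠ hdR a then (if tlR a = l then (1 : ℤ) else 0) else 0) +
        ∑ b, if tlC b ≠ hdC b then (if tlC b = l then (1 : ℤ) else 0) else 0 := by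
    rw [card_filter_eq_sum_ite, Finset.sum_filter, Fintype.sum_sum_type]; rfl
  rw [ind_ne_inner_right tlR hdR, ind_ne_inner_right tlC hdC] at e1
  rw [ind_ne_inner_left tlR hdR, ind_ne_inner_left tlC hdC] at e2
  have : (((univ.filter fun i : Fin m ⊕ Fin m => Sum.elim tlR tlC i ≠ Sum.elim hdR hdC i).filter
        fun i => Sum.elim hdR hdC i = l).card : ℤ) =
      (((univ.filter fun i : Fin m ⊕ Fin m => Sum.elim tlR tlC i ≠ Sum.elim hdR hdC i).filter
        fun i => Sum.elim tlR tlC i = l).card : ℤ) := by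
    rw [e1, e2]; linarith
  exact_mod_cast this

/-! ## 3. Sign transfer on a simple balanced family, and the potential step -/

/-- double indicator sums collapse. [folklore] -/
theorem sum_mul_indicator (S : Finset (Fin m ⊕ Fin m)) (g : Fin m → Fin K) (F : Fin K → ℤ) :
    ∑ l, F l * (∑ b, if Sum.inr b ∈ S then (if g b = l then (1 : ℤ) else 0) else 0) =
      ∑ b, if Sum.inr b ∈ S then F (g b) else 0 := by
  simp_rw [Finset.mul_sum]
  rw [Finset.sum_comm]
  refine Finset.sum_congr rfl fun b _ => ?_
  by_cases h : Sum.inr b ∈ S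
  · simp only [h, if_true, mul_ite, mul_one, mul_zero]
    rw [Finset.sum_ite_eq univ (g b) F]
    simp
  · simp [h]

/-- **Sign transfer.**  On a simple balanced family `S` of arcs between the class maps of two terms `p`, `p'`, the vector
`z l = #(columns of S entering l) − #(columns of S leaving l)` has entries in `{−1, 0, 1}` and total `0`; so a potential `u`
that is sign-equivalent to `e` on such vectors inherits the sign of the `e`-slope change of `S`. [this file] -/
theorem circuit_sign (e : Fin K → ℕ) (u : Fin K → ℤ)
    (hu : ∀ z : Fin K → ℤ, (∀ l, z l = -1 ∨ z l = 0 ∨ z l = 1) → ∑ l, z l = 0 →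
      (0 ≤ ∑ l, (e l : ℤ) * z l → 0 ≤ ∑ l, u l * z l) ∧ (0 < ∑ l, (e l : ℤ) * z l → 0 < ∑ l, u l * z l))
    (p p' : Equiv.Perm (Fin m) × (Fin m → Fin K)) (S : Finset (Fin m ⊕ Fin m))
    (hSbal : ∀ l, (S.filter fun i => Sum.elim (fun a => p'.2 (p'.1.symm a)) (fun b => p.2 b) i = l).card =
      (S.filter fun i => Sum.elim (fun a => p.2 (p.1.symm a)) (fun b => p'.2 b) i = l).card)
    (hSsimple : ∀ l, (S.filter fun i => Sum.elim (fun a => p'.2 (p'.1.symm a)) (fun b => p.2 b) i = l).card ≤ 1)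
    (hδ : 0 ≤ ∑ b, if Sum.inr b ∈ S then ((e (p'.2 b) : ℤ) - e (p.2 b)) else 0) :
    0 ≤ (∑ b, if Sum.inr b ∈ S then (u (p'.2 b) - u (p.2 b)) else 0) ∧
      (0 < (∑ b, if Sum.inr b ∈ S then ((e (p'.2 b) : ℤ) - e (p.2 b)) else 0) →
        1 ≤ ∑ b, if Sum.inr b ∈ S then (u (p'.2 b) - u (p.2 b)) else 0) := by
  classical
  -- the vector `z`
  set A : Fin K → ℤ := fun l => ∑ b, if Sum.inr b ∈ S then (if p'.2 b = l then (1 : ℤ) else 0) else 0 with hA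
  set Bc : Fin K → ℤ := fun l => ∑ b, if Sum.inr b ∈ S then (if p.2 b = l then (1 : ℤ) else 0) else 0 with hBc
  have hA0 : ∀ l, 0 ≤ A l := fun l => sum_ite_ite_nonneg S p'.2 l
  have hB0 : ∀ l, 0 ≤ Bc l := fun l => sum_ite_ite_nonneg S p.2 l
  have hA1 : ∀ l, A l ≤ 1 := by
    intro l
    have h1 := sum_ite_inr_le_card S (fun a => p.2 (p.1.symm a)) p'.2 l
    have h2 : ((S.filter fun i => Sum.elim (fun a => p.2 (p.1.symm a)) (fun b => p'.2 b) i = l).card : ℤ) ≤ 1 := by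
      rw [← hSbal l]; exact_mod_cast hSsimple l
    exact h1.trans h2
  have hB1 : ∀ l, Bc l ≤ 1 := by
    intro l
    have h1 := sum_ite_inr_le_card S (fun a => p'.2 (p'.1.symm a)) p.2 l
    have h2 : ((S.filter fun i => Sum.elim (fun a => p'.2 (p'.1.symm a)) (fun b => p.2 b) i = l).card : ℤ) ≤ 1 := by
      exact_mod_cast hSsimple l
    exact h1.trans h2
  have hz1 : ∀ l, A l - Bc l = -1 ∨ A l - Bc l = 0 ∨ A l - Bc l = 1 := by
    intro l
    have := hA0 l; have := hA1 l; have := hB0 l; have := hB1 l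
    omega
  -- total zero
  have hsumA : ∀ (g : Fin m → Fin K), ∑ l, (∑ b, if Sum.inr b ∈ S then (if g b = l then (1 : ℤ) else 0) else 0) =
      ∑ b, if Sum.inr b ∈ S then (1 : ℤ) else 0 := by
    intro g
    have := sum_mul_indicator S g (fun _ => 1)
    simpa using this
  have hz2 : ∑ l, (A l - Bc l) = 0 := by
    rw [Finset.sum_sub_distrib, hA, hBc, hsumA p'.2, hsumA p.2, sub_self]
  -- the two sums as `⟨e, z⟩` and `⟨u, z⟩`
  have hze : ∑ l, (e l : ℤ) * (A l - Bc l) = ∑ b, if Sum.inr b ∈ S then ((e (p'.2 b) : ℤ) - e (p.2 b)) else 0 := by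
    simp_rw [mul_sub]
    rw [Finset.sum_sub_distrib, hA, hBc, sum_mul_indicator S p'.2 (fun l => (e l : ℤ)),
      sum_mul_indicator S p.2 (fun l => (e l : ℤ)), ← Finset.sum_sub_distrib]
    refine Finset.sum_congr rfl fun b _ => ?_
    split_ifs <;> simp
  have hzu : ∑ l, u l * (A l - Bc l) = ∑ b, if Sum.inr b ∈ S then (u (p'.2 b) - u (p.2 b)) else 0 := by
    simp_rw [mul_sub]
    rw [Finset.sum_sub_distrib, hA, hBc, sum_mul_indicator S p'.2 u, sum_mul_indicator S p.2 u,
      ← Finset.sum_sub_distrib]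
    refine Finset.sum_congr rfl fun b _ => ?_
    split_ifs <;> simp
  have key := hu (fun l => A l - Bc l) hz1 hz2
  rw [hze, hzu] at key
  exact ⟨key.1 hδ, fun h => key.2 h⟩

/-- slopes strictly increase along dominant terms (the tree's `slope_lt_of_dominant`, restated to stay import-light). [folklore] -/
theorem sum_d_lt_of_dominant (d : Fin K → ℕ) (v ε : Fin m → Fin m → Fin K → ℤ) {θa θb : ℤ} (hab : θa < θb)
    {p p' : Equiv.Perm (Fin m) × (Fin m → Fin K)} (hne : p ≠ p') (ha : IsDominant d v ε θa p)
    (hb : IsDominant d v ε θb p') : ∑ i, (d (p.2 i) : ℤ) < ∑ i, (d (p'.2 i) : ℤ) := by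
  have h1 := ha.2 p' (Ne.symm hne) hb.1
  have h2 := hb.2 p hne ha.1
  unfold tropWeight at h1 h2
  by_contra hcon
  push Not at hcon
  nlinarith

/-- **THE POTENTIAL STEP.**  In the two-sided separable sector, for ANY integer vector `u` sign-equivalent to the reduced exponents `e`
on balanced vectors of `{−1,0,1}^K`, the column potential `Σ_b u(class of column b)` increases by at least one from a term dominant at
`θa` to a different term dominant at `θb > θa`. [this file] -/
theorem potential_step (e : Fin K → ℕ) (M : ℕ) (d : Fin K → ℕ) (hd : ∀ l, d l = M * e l)
    (r c : Fin m → Fin K → ℤ) (w : Fin m → Fin m → ℤ) (B : ℤ)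
    (hw0 : ∀ a b, 0 ≤ w a b) (hwB : ∀ a b, w a b ≤ B) (hMB : (m : ℤ) * B < M)
    (v ε : Fin m → Fin m → Fin K → ℤ) (hv : ∀ a b l, v a b l = (M : ℤ) * (r a l + c b l) + w a b)
    (hε : ∀ a b l, ε a b l ≠ 0) (u : Fin K → ℤ)
    (hu : ∀ z : Fin K → ℤ, (∀ l, z l = -1 ∨ z l = 0 ∨ z l = 1) → ∑ l, z l = 0 →
      (0 ≤ ∑ l, (e l : ℤ) * z l → 0 ≤ ∑ l, u l * z l) ∧ (0 < ∑ l, (e l : ℤ) * z l → 0 < ∑ l, u l * z l))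
    {θa θb : ℤ} (hab : θa < θb) {p p' : Equiv.Perm (Fin m) × (Fin m → Fin K)} (hne : p ≠ p')
    (hp : IsDominant d v ε θa p) (hp' : IsDominant d v ε θb p') :
    ∑ b, u (p.2 b) + 1 ≤ ∑ b, u (p'.2 b) := by
  classical
  -- the balanced family of changed agents
  have hrow : ∀ (q : Equiv.Perm (Fin m) × (Fin m → Fin K)) (l : Fin K),
      (∑ a, if q.2 (q.1.symm a) = l then (1 : ℤ) else 0) = ∑ b, if q.2 b = l then (1 : ℤ) else 0 :=
    fun q l => Equiv.sum_comp q.1.symm (fun b => if q.2 b = l then (1 : ℤ) else 0)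
  have hDbal : ∀ l,
      ((univ.filter fun i : Fin m ⊕ Fin m =>
          Sum.elim (fun a => p.2 (p.1.symm a)) (fun b => p'.2 b) i ≠ Sum.elim (fun a => p'.2 (p'.1.symm a)) (fun b => p.2 b) i).filter
        fun i => Sum.elim (fun a => p'.2 (p'.1.symm a)) (fun b => p.2 b) i = l).card =
      ((univ.filter fun i : Fin m ⊕ Fin m =>
          Sum.elim (fun a => p.2 (p.1.symm a)) (fun b => p'.2 b) i ≠ Sum.elim (fun a => p'.2 (p'.1.symm a)) (fun b => p.2 b) i).filter
        fun i => Sum.elim (fun a => p.2 (p.1.symm a)) (fun b => p'.2 b) i = l).card := by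
    intro l
    refine changed_balanced (fun a => p.2 (p.1.symm a)) (fun a => p'.2 (p'.1.symm a)) (fun b => p'.2 b) (fun b => p.2 b) l ?_
    have h1 := hrow p l
    have h2 := hrow p' l
    linarith
  -- the circuit hypothesis of part 1
  have H := ClassCircuit.circuit_potential
    (Sum.elim (fun a => p.2 (p.1.symm a)) (fun b => p'.2 b)) (Sum.elim (fun a => p'.2 (p'.1.symm a)) (fun b => p.2 b))
    (Sum.elim (fun _ => (0 : ℤ)) (fun b => (e (p'.2 b) : ℤ) - e (p.2 b)))
    (Sum.elim (fun _ => (0 : ℤ)) (fun b => u (p'.2 b) - u (p.2 b)))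
    (univ.filter fun i : Fin m ⊕ Fin m =>
          Sum.elim (fun a => p.2 (p.1.symm a)) (fun b => p'.2 b) i ≠ Sum.elim (fun a => p'.2 (p'.1.symm a)) (fun b => p.2 b) i)
    hDbal ?_
  · -- conclude from the total sums
    have hf : ∀ (F : Fin K → ℤ), (∑ i ∈ (univ.filter fun i : Fin m ⊕ Fin m =>
          Sum.elim (fun a => p.2 (p.1.symm a)) (fun b => p'.2 b) i ≠ Sum.elim (fun a => p'.2 (p'.1.symm a)) (fun b => p.2 b) i),
          Sum.elim (fun _ => (0 : ℤ)) (fun b => F (p'.2 b) - F (p.2 b)) i) = ∑ b, F (p'.2 b) - ∑ b, F (p.2 b) := by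
      intro F
      rw [Finset.sum_filter, Fintype.sum_sum_type]
      have h0 : ∑ a : Fin m, (if Sum.elim (fun a => p.2 (p.1.symm a)) (fun b => p'.2 b) (Sum.inl a) ≠
          Sum.elim (fun a => p'.2 (p'.1.symm a)) (fun b => p.2 b) (Sum.inl a)
          then Sum.elim (fun _ => (0 : ℤ)) (fun b => F (p'.2 b) - F (p.2 b)) (Sum.inl a) else 0) = 0 :=
        Finset.sum_eq_zero fun a _ => by split_ifs <;> rfl
      rw [h0, zero_add, ← Finset.sum_sub_distrib]
      refine Finset.sum_congr rfl fun b _ => ?_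
      show (if p'.2 b ≠ p.2 b then F (p'.2 b) - F (p.2 b) else 0) = F (p'.2 b) - F (p.2 b)
      split_ifs with h
      · rfl
      · push Not at h; rw [h, sub_self]
    have hfe := hf (fun l => (e l : ℤ))
    have hfu := hf u
    rw [hfe, hfu] at H
    have hslope := sum_d_lt_of_dominant d v ε hab hne hp hp'
    simp only [hd, Nat.cast_mul] at hslope
    rw [← Finset.mul_sum, ← Finset.mul_sum] at hslope
    have hslope' : ∑ i, (e (p.2 i) : ℤ) < ∑ i, (e (p'.2 i) : ℤ) := lt_of_mul_lt_mul_left hslope (by positivity)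
    linarith [H.2 (by linarith)]
  · -- every simple balanced sub-family points up
    intro S hSsub hSne hSbal hSsimple
    have hSD : ∀ i ∈ S, Sum.elim (fun a => p.2 (p.1.symm a)) (fun b => p'.2 b) i ≠
        Sum.elim (fun a => p'.2 (p'.1.symm a)) (fun b => p.2 b) i :=
      fun i hi => (Finset.mem_filter.mp (hSsub hi)).2
    have m1 := move_ineq e M d hd r c w B hw0 hwB hMB v ε hv hε hp p' S hSne hSD hSbal
    have m2 := move_ineq e M d hd r c w B hw0 hwB hMB v ε hv hε hp' p S hSne (fun i hi => (hSD i hi).symm)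
      (fun l => (hSbal l).symm)
    -- `m2` is `m1` with all three sums negated
    have n1 : (∑ b, if Sum.inr b ∈ S then ((e (p.2 b) : ℤ) - e (p'.2 b)) else 0) =
        -∑ b, if Sum.inr b ∈ S then ((e (p'.2 b) : ℤ) - e (p.2 b)) else 0 := by
      rw [← Finset.sum_neg_distrib]; exact Finset.sum_congr rfl fun b _ => by split_ifs <;> ring
    have n2 : (∑ a, if Sum.inl a ∈ S then (r a (p.2 (p.1.symm a)) - r a (p'.2 (p'.1.symm a))) else 0) =
        -∑ a, if Sum.inl a ∈ S then (r a (p'.2 (p'.1.symm a)) - r a (p.2 (p.1.symm a))) else 0 := by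
      rw [← Finset.sum_neg_distrib]; exact Finset.sum_congr rfl fun a _ => by split_ifs <;> ring
    have n3 : (∑ b, if Sum.inr b ∈ S then (c b (p.2 b) - c b (p'.2 b)) else 0) =
        -∑ b, if Sum.inr b ∈ S then (c b (p'.2 b) - c b (p.2 b)) else 0 := by
      rw [← Finset.sum_neg_distrib]; exact Finset.sum_congr rfl fun b _ => by split_ifs <;> ring
    rw [n1, n2, n3] at m2
    have hδ : 0 ≤ ∑ b, if Sum.inr b ∈ S then ((e (p'.2 b) : ℤ) - e (p.2 b)) else 0 := by nlinarith
    have hsign := circuit_sign e u hu p p' S hSbal hSsimple hδ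
    -- the sums over `S` of the per-arc weights are the column sums
    have hS : ∀ (F : Fin K → ℤ), ∑ i ∈ S, Sum.elim (fun _ => (0 : ℤ)) (fun b => F (p'.2 b) - F (p.2 b)) i =
        ∑ b, if Sum.inr b ∈ S then (F (p'.2 b) - F (p.2 b)) else 0 := by
      intro F
      rw [sum_over_sum_type]
      have h0 : ∑ a : Fin m, (if Sum.inl a ∈ S then Sum.elim (fun _ => (0 : ℤ)) (fun b => F (p'.2 b) - F (p.2 b)) (Sum.inl a)
          else 0) = 0 := Finset.sum_eq_zero fun a _ => by split_ifs <;> rfl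
      rw [h0, zero_add]
      rfl
    rw [hS (fun l => (e l : ℤ)), hS u]
    exact hsign


/-! ## 4. The sector law along a chain -/

/-- **THE TWO-SIDED SEPARABLE SECTOR LAW.**  In the sector (`d = M·e`, `v a b l = M(r a l + c b l) + w a b`, `0 ≤ w ≤ B`, `m·B < M`,
full support), every chain `p₀, …, pₙ` of terms dominant at strictly increasing integer slopes with consecutive terms distinct has
`n ≤ m · (U₁ − U₀)` for ANY integer vector `u` with values in `[U₀, U₁]` that is sign-equivalent to `e` on balanced vectors of
`{−1,0,1}^K`. [this file] -/
theorem chain_le (e : Fin K → ℕ) (M : ℕ) (d : Fin K → ℕ) (hd : ∀ l, d l = M * e l)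
    (r c : Fin m → Fin K → ℤ) (w : Fin m → Fin m → ℤ) (B : ℤ)
    (hw0 : ∀ a b, 0 ≤ w a b) (hwB : ∀ a b, w a b ≤ B) (hMB : (m : ℤ) * B < M)
    (v ε : Fin m → Fin m → Fin K → ℤ) (hv : ∀ a b l, v a b l = (M : ℤ) * (r a l + c b l) + w a b)
    (hε : ∀ a b l, ε a b l ≠ 0) (u : Fin K → ℤ)
    (hu : ∀ z : Fin K → ℤ, (∀ l, z l = -1 ∨ z l = 0 ∨ z l = 1) → ∑ l, z l = 0 →
      (0 ≤ ∑ l, (e l : ℤ) * z l → 0 ≤ ∑ l, u l * z l) ∧ (0 < ∑ l, (e l : ℤ) * z l → 0 < ∑ l, u l * z l))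
    (U₀ U₁ : ℤ) (hU : ∀ l, U₀ ≤ u l ∧ u l ≤ U₁)
    {n : ℕ} (θ : Fin (n + 1) → ℤ) (p : Fin (n + 1) → Equiv.Perm (Fin m) × (Fin m → Fin K))
    (hθ : StrictMono θ) (hdom : ∀ k, IsDominant d v ε (θ k) (p k)) (hne : ∀ k : Fin n, p k.castSucc ≠ p k.succ) :
    (n : ℤ) ≤ m * (U₁ - U₀) := by
  -- the column potential climbs by one at every step
  have hclimb : ∀ i : ℕ, ∀ hi : i ≤ n, (∑ b, u ((p 0).2 b)) + i ≤ ∑ b, u ((p ⟨i, Nat.lt_succ_of_le hi⟩).2 b) := by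
    intro i
    induction i with
    | zero => intro hi; simp
    | succ i ih =>
      intro hi
      have h1 := ih (Nat.le_of_succ_le hi)
      have hk : (⟨i, by omega⟩ : Fin (n + 1)) = (⟨i, by omega⟩ : Fin n).castSucc := rfl
      have hk' : (⟨i + 1, Nat.lt_succ_of_le hi⟩ : Fin (n + 1)) = (⟨i, by omega⟩ : Fin n).succ := rfl
      have hstep := potential_step e M d hd r c w B hw0 hwB hMB v ε hv hε u hu
        (hθ (Fin.castSucc_lt_succ (i := ⟨i, by omega⟩))) (hne ⟨i, by omega⟩) (hdom _) (hdom _)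
      rw [← hk, ← hk'] at hstep
      push_cast
      linarith
  have hlow : (m : ℤ) * U₀ ≤ ∑ b, u ((p 0).2 b) := by
    calc (m : ℤ) * U₀ = ∑ _b : Fin m, U₀ := by simp
      _ ≤ ∑ b, u ((p 0).2 b) := Finset.sum_le_sum fun b _ => (hU _).1
  have hhigh : ∑ b, u ((p ⟨n, Nat.lt_succ_self n⟩).2 b) ≤ (m : ℤ) * U₁ := by
    calc ∑ b, u ((p ⟨n, Nat.lt_succ_self n⟩).2 b) ≤ ∑ _b : Fin m, U₁ := Finset.sum_le_sum fun b _ => (hU _).2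
      _ = (m : ℤ) * U₁ := by simp
  have := hclimb n le_rfl
  linarith

/-- **The sector law in the currency of `TropicalCensus.TropRootLawAt`** (sign-alternating dominant chains): under the sector hypotheses
and a sign-equivalent `u` with values in `[U₀, U₁]`, every chain in the hypothesis list of the tropical census row has `n ≤ m·(U₁ − U₀)`.
[this file] -/
theorem chain_le_alt (e : Fin K → ℕ) (M : ℕ) (d : Fin K → ℕ) (hd : ∀ l, d l = M * e l)
    (r c : Fin m → Fin K → ℤ) (w : Fin m → Fin m → ℤ) (B : ℤ)
    (hw0 : ∀ a b, 0 ≤ w a b) (hwB : ∀ a b, w a b ≤ B) (hMB : (m : ℤ) * B < M)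
    (v ε : Fin m → Fin m → Fin K → ℤ) (hv : ∀ a b l, v a b l = (M : ℤ) * (r a l + c b l) + w a b)
    (hε : ∀ a b l, ε a b l ≠ 0) (u : Fin K → ℤ)
    (hu : ∀ z : Fin K → ℤ, (∀ l, z l = -1 ∨ z l = 0 ∨ z l = 1) → ∑ l, z l = 0 →
      (0 ≤ ∑ l, (e l : ℤ) * z l → 0 ≤ ∑ l, u l * z l) ∧ (0 < ∑ l, (e l : ℤ) * z l → 0 < ∑ l, u l * z l))
    (U₀ U₁ : ℤ) (hU : ∀ l, U₀ ≤ u l ∧ u l ≤ U₁)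
    {n : ℕ} (θ : Fin (n + 1) → ℤ) (p : Fin (n + 1) → Equiv.Perm (Fin m) × (Fin m → Fin K))
    (hθ : StrictMono θ) (hdom : ∀ k, IsDominant d v ε (θ k) (p k))
    (halt : ∀ k : Fin n, termSign ε (p k.castSucc) * termSign ε (p k.succ) < 0) :
    (n : ℤ) ≤ m * (U₁ - U₀) :=
  -- consecutive terms are distinct (their signs multiply to a negative number; cf. `SeparatedLex.ne_of_termSign_mul_neg`)
  chain_le e M d hd r c w B hw0 hwB hMB v ε hv hε u hu U₀ U₁ hU θ p hθ hdom fun k hk => by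
    have h := halt k
    rw [hk] at h
    exact absurd h (not_lt.mpr (mul_self_nonneg _))

end TwoSided

end Summit.ValiantsHypothesis.ValiantsHypothesis.Theorems.KPlusLogSqLaw
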